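import Summits.QuantumFields.YangMills.Theorems.OneCertifiedCubeCrossoverCertificateDefs
import Literature.MathematicalPhysics.QuantumLattice.LatticeGaugeDLRGibbsProofs

/-!
# Route `OneCertifiedCube`, crux `CrossoverCertificate` (stmt-QuantumFields-16125): locality of the TV influence

Helper file (lead c2, 2026-08-17) for the registered line `registered` (`Cruxes/CrossoverCertificate/Lines/birth.lean`).
The crux's finite-size condition bounds, for cell unions `A = ⋃_{y ∈ Y} cell_w(y)` with `0 ∈ Y ⊆ [-2n,2n]⁴` and boundary
conditions `η, η′` agreeing on the cube of `(4n+1)⁴` cells, the influence `|∫ f dγ_A(·|η) − ∫ f dγ_A(·|η′)|` on cylinder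
functions `f` of the central cell (`γ = ymSpecification ρ β`, the Wilson specification).  We prove the MARKOV/LOCALITY
structure of this functional that every analysis of the crux uses informally (the frozen-coupling no-go
`exists_beta0_half_le_influence` takes `Y` = the whole cube; the refuters' coherent-layer risk lives on the cube's faces):

* `exists_cell_of_near` — frame bookkeeping: a site within sup-distance `1` of a site of cell `y` of a `[b,2b]`-frame
  (`b ≥ 1`) lies in a cell `y′` with `|y′ᵢ − yᵢ| ≤ 1`;
* `plaquetteEdges_subset_cubeEdges_of_interior` — if every cell of `Y` is INTERIOR (`|yᵢ| ≤ 2n − 1`), every edge of every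
  plaquette touching `A` is an edge of the cube (Wilson's action has range one lattice spacing ≤ one cell);
* `integral_ymSpecification_eq_of_interior` — consequently the two kernel integrals in the crux's condition are EQUAL for
  interior `Y` (tree quasilocality `dependsOn_integral_ymSpecification`): the influence vanishes identically unless the
  cell union reaches the boundary shell `max |yᵢ| = 2n` of the cube; in particular the central cell alone (`Y = {0}`,
  `n ≥ 1`) feels nothing (`integral_ymSpecification_eq_of_singleton_zero`), and the supremum `influence ρ β b n` is
  carried by "channels" from the shell to the centre.

Nothing about Yang–Mills dynamics is asserted; pure specification bookkeeping (Georgii 2011 (2.15): kernels of a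
finite-range specification are quasilocal).  No definition is introduced: the cell sets are written VERBATIM as in
`Summit.QuantumFields.YangMills.Theses.OneCertifiedCube.CrossoverCertificate`.
-/

set_option autoImplicit false

noncomputable section

namespace Summit.QuantumFields.YangMills.Cruxes.CrossoverCertificate.Birth

open MeasureTheory Finset
open Literature.MathematicalPhysics.QuantumLattice Literature.Probability.LatticeModels

/-- **Frame bookkeeping.** For a `[b,2b]`-frame `w` with `b ≥ 1` (so each coordinate frame is strictly increasing with
gaps `≥ 1`): if `x₀` lies in cell `y` (`w i (y i) ≤ x₀ i < w i (y i + 1)`) and `x₁` is within sup-distance `1` of `x₀`,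
then `x₁` lies in a cell `y′` with `y i − 1 ≤ y′ i ≤ y i + 1`. [folklore] -/
theorem exists_cell_of_near {b : ℕ} (hb : 1 ≤ b) {w : Fin 4 → ℤ → ℤ}
    (hw : ∀ i j, w i j + ((b : ℕ) : ℤ) ≤ w i (j + 1) ∧ w i (j + 1) ≤ w i j + 2 * ((b : ℕ) : ℤ))
    {y x₀ x₁ : Fin 4 → ℤ} (hx₀ : ∀ i, w i (y i) ≤ x₀ i ∧ x₀ i < w i (y i + 1))
    (hnear : ∀ i, x₀ i - 1 ≤ x₁ i ∧ x₁ i ≤ x₀ i + 1) :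
    ∃ y' : Fin 4 → ℤ, (∀ i, y i - 1 ≤ y' i ∧ y' i ≤ y i + 1) ∧ ∀ i, w i (y' i) ≤ x₁ i ∧ x₁ i < w i (y' i + 1) := by
  have hb' : (1 : ℤ) ≤ ((b : ℕ) : ℤ) := by exact_mod_cast hb
  refine ⟨fun i => if x₁ i < w i (y i) then y i - 1 else if x₁ i < w i (y i + 1) then y i else y i + 1,
    fun i => ?_, fun i => ?_⟩
  · dsimp only
    split_ifs <;> omega
  · dsimp only
    have h0 := hx₀ i
    have h1 := hnear i
    have hlo := (hw i (y i - 1)).1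
    have hhi := (hw i (y i + 1)).1
    simp only [sub_add_cancel] at hlo
    split_ifs with hlt hlt'
    · simp only [sub_add_cancel]
      omega
    · omega
    · omega

/-- **Plaquettes touching an interior cell union stay inside the cube.** Let `w` be a `[b,2b]`-frame with `b ≥ 1` and
let every cell index of `Y` be interior, `|yᵢ| ≤ 2n − 1`.  Then every edge of every plaquette touching
`A = ⋃_{y ∈ Y} cell_w(y)` is an edge of one of the `(4n+1)⁴` cells of the cube `[-2n,2n]⁴` (the sets are VERBATIM those of
the crux). [folklore] -/
theorem plaquetteEdges_subset_cubeEdges_of_interior {b n : ℕ} (hb : 1 ≤ b) {w : Fin 4 → ℤ → ℤ}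
    (hw : ∀ i j, w i j + ((b : ℕ) : ℤ) ≤ w i (j + 1) ∧ w i (j + 1) ≤ w i j + 2 * ((b : ℕ) : ℤ))
    {Y : Finset (Fin 4 → ℤ)} (hY : ∀ y ∈ Y, ∀ i, -(2 * (n : ℤ)) + 1 ≤ y i ∧ y i ≤ 2 * (n : ℤ) - 1)
    {p : ZdPlaquette 4}
    (hp : p ∈ plaquettesTouching (Y.biUnion fun y : Fin 4 → ℤ =>
      (Fintype.piFinset fun i : Fin 4 => Finset.Ico (w i (y i)) (w i (y i + 1))) ×ˢ (Finset.univ : Finset (Fin 4)))) :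
    plaquetteEdges p ⊆ (Fintype.piFinset fun _ : Fin 4 => Finset.Icc (-(2 * ((n : ℕ) : ℤ))) (2 * ((n : ℕ) : ℤ))).biUnion
      (fun y : Fin 4 → ℤ => (Fintype.piFinset fun i : Fin 4 => Finset.Ico (w i (y i)) (w i (y i + 1))) ×ˢ
        (Finset.univ : Finset (Fin 4))) := by
  -- an edge `e₀` of `p` inside some cell `y ∈ Y`
  obtain ⟨e₀, he₀⟩ := mem_plaquettesTouching_iff.1 hp
  obtain ⟨he₀p, he₀A⟩ := Finset.mem_inter.1 he₀
  obtain ⟨y, hyY, he₀y⟩ := Finset.mem_biUnion.1 he₀A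
  have hx₀ : ∀ i, w i (y i) ≤ e₀.1 i ∧ e₀.1 i < w i (y i + 1) := by
    have h := (Finset.mem_product.1 he₀y).1
    rw [Fintype.mem_piFinset] at h
    exact fun i => Finset.mem_Ico.1 (h i)
  -- every base point of an edge of `p` is within sup-distance 1 of every other
  have hbase : ∀ e ∈ plaquetteEdges p, ∀ i, p.1 i ≤ e.1 i ∧ e.1 i ≤ p.1 i + 1 := by
    intro e he i
    simp only [plaquetteEdges, Finset.mem_insert, Finset.mem_singleton] at he
    rcases he with rfl | rfl | rfl | rfl
    · simp
    · simp only [Pi.add_apply, Pi.single_apply]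
      split_ifs <;> omega
    · simp only [Pi.add_apply, Pi.single_apply]
      split_ifs <;> omega
    · simp
  intro e he
  have hnear : ∀ i, e₀.1 i - 1 ≤ e.1 i ∧ e.1 i ≤ e₀.1 i + 1 := fun i => by
    have h1 := hbase e he i
    have h2 := hbase e₀ he₀p i
    omega
  obtain ⟨y', hy', hy'e⟩ := exists_cell_of_near hb hw hx₀ hnear
  have hyb := hY y hyY
  refine Finset.mem_biUnion.2 ⟨y', ?_, ?_⟩
  · rw [Fintype.mem_piFinset]
    intro i
    rw [Finset.mem_Icc]
    have h1 := hy' i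
    have h2 := hyb i
    omega
  · refine Finset.mem_product.2 ⟨?_, Finset.mem_univ _⟩
    rw [Fintype.mem_piFinset]
    exact fun i => Finset.mem_Ico.2 (hy'e i)

/-- **Locality of the TV influence (interior cell unions feel nothing).** In the setting of the crux's finite-size
condition — a `[b,2b]`-frame `w` with `b ≥ 1`, boundary conditions `η, η′` agreeing on every edge of the cube of
`(4n+1)⁴` cells, a measurable cylinder function `f` of the central cell — if every cell of `Y` is INTERIOR
(`|yᵢ| ≤ 2n − 1`) then the two Wilson kernel integrals coincide:
`∫ f dγ_A(·|η) = ∫ f dγ_A(·|η′)`, `A = ⋃_{y ∈ Y} cell_w(y)`.  Reason: by quasilocality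
(`dependsOn_integral_ymSpecification`) the kernel average depends on the boundary condition only through the central
cell and the edges of plaquettes touching `A`, all of which are cube edges
(`plaquetteEdges_subset_cubeEdges_of_interior`).  Hence in `influence ρ β b n` only cell unions reaching the boundary
shell `max |yᵢ| = 2n` contribute.  (Registered sub-goal of crux stmt-QuantumFields-16125; one-line signature.) [folklore] -/
theorem integral_ymSpecification_eq_of_interior : ∀ {G : Type} [Group G] [TopologicalSpace G] [IsTopologicalGroup G] [CompactSpace G] [MeasurableSpace G] [BorelSpace G] [SecondCountableTopology G] {N : ℕ} (ρ : G →* Matrix (Fin N) (Fin N) ℂ), Continuous ρ → ∀ (β : ℝ) {b n : ℕ}, 1 ≤ b → ∀ {w : Fin 4 → ℤ → ℤ}, (∀ i j, w i j + ((b : ℕ) : ℤ) ≤ w i (j + 1) ∧ w i (j + 1) ≤ w i j + 2 * ((b : ℕ) : ℤ)) → ∀ {Y : Finset (Fin 4 → ℤ)}, (∀ y ∈ Y, ∀ i, -(2 * (n : ℤ)) + 1 ≤ y i ∧ y i ≤ 2 * (n : ℤ) - 1) → ∀ {η η' : Literature.MathematicalPhysics.QuantumLattice.LGConfig 4 G},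 (∀ e ∈ (Fintype.piFinset fun _ : Fin 4 => Finset.Icc (-(2 * ((n : ℕ) : ℤ))) (2 * ((n : ℕ) : ℤ))).biUnion (fun y : Fin 4 → ℤ => (Fintype.piFinset fun i : Fin 4 => Finset.Ico (w i (y i)) (w i (y i + 1))) ×ˢ (Finset.univ : Finset (Fin 4))), η e = η' e) → ∀ {f : Literature.MathematicalPhysics.QuantumLattice.LGConfig 4 G → ℝ}, Literature.MathematicalPhysics.QuantumLattice.IsCylinder f ((fun y : Fin 4 → ℤ => (Fintype.piFinset fun i : Fin 4 => Finset.Ico (w i (y i)) (w i (y i + 1))) ×ˢ (Finset.univ : Finset (Fin 4))) 0) → Measurable f → (∫ U, f U ∂(Literature.MathematicalPhysics.QuantumLattice.ymSpecification ρ β (Y.biUnion (fun y : Fin 4 → ℤ => (Fintype.piFinset fun i : Fin 4 => Finset.Ico (w i (y i)) (w i (y i + 1))) ×ˢ (Finset.univ : Finset (Fin 4)))) η)) = ∫ U, f U ∂(Literature.MathematicalPhysics.QuantumLattice.ymSpecification ρ β (Y.biUnion (fun y : Fin 4 → ℤ => (Fintype.piFinset fun i : Fin 4 => Finset.Ico (w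 i (y i)) (w i (y i + 1))) ×ˢ (Finset.univ : Finset (Fin 4)))) η') := by
  intro G _ _ _ _ _ _ _ N ρ hρ β b n hb w hw Y hY η η' hηη' f hf hfm
  have hdep := dependsOn_integral_ymSpecification ρ hρ β
    (Y.biUnion (fun y : Fin 4 → ℤ =>
      (Fintype.piFinset fun i : Fin 4 => Finset.Ico (w i (y i)) (w i (y i + 1))) ×ˢ (Finset.univ : Finset (Fin 4))))
    hfm hf
  refine hdep fun e he => hηη' e ?_
  rcases Finset.mem_union.1 (Finset.mem_coe.1 he) with he0 | heP
  · -- the central cell is a cell of the cube (`0 ∈ [-2n,2n]⁴`)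
    refine Finset.mem_biUnion.2 ⟨0, ?_, he0⟩
    rw [Fintype.mem_piFinset]
    intro i
    simp
  · obtain ⟨p, hp, hep⟩ := Finset.mem_biUnion.1 heP
    exact plaquetteEdges_subset_cubeEdges_of_interior hb hw hY hp hep

variable {G : Type} [Group G] [TopologicalSpace G] [IsTopologicalGroup G] [CompactSpace G]
  [MeasurableSpace G] [BorelSpace G] [SecondCountableTopology G]

/-- **The central cell alone feels nothing (`n ≥ 1`).** With `Y = {0}` the cell union is the central cell, which is
interior as soon as `n ≥ 1`; so `∫ f dγ_{cell 0}(·|η) = ∫ f dγ_{cell 0}(·|η′)` for every pair of boundary conditions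
agreeing on the cube — the influence in the crux is transmitted only through cell unions that reach the cube's boundary
shell. [folklore] -/
theorem integral_ymSpecification_eq_of_singleton_zero {N : ℕ} (ρ : G →* Matrix (Fin N) (Fin N) ℂ) (hρ : Continuous ρ)
    (β : ℝ) {b n : ℕ} (hb : 1 ≤ b) (hn : 1 ≤ n) {w : Fin 4 → ℤ → ℤ}
    (hw : ∀ i j, w i j + ((b : ℕ) : ℤ) ≤ w i (j + 1) ∧ w i (j + 1) ≤ w i j + 2 * ((b : ℕ) : ℤ))
    {η η' : LGConfig 4 G}
    (hηη' : ∀ e ∈ (Fintype.piFinset fun _ : Fin 4 => Finset.Icc (-(2 * ((n : ℕ) : ℤ))) (2 * ((n : ℕ) : ℤ))).biUnion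
      (fun y : Fin 4 → ℤ => (Fintype.piFinset fun i : Fin 4 => Finset.Ico (w i (y i)) (w i (y i + 1))) ×ˢ
        (Finset.univ : Finset (Fin 4))), η e = η' e)
    {f : LGConfig 4 G → ℝ}
    (hf : IsCylinder f ((fun y : Fin 4 → ℤ => (Fintype.piFinset fun i : Fin 4 => Finset.Ico (w i (y i)) (w i (y i + 1))) ×ˢ
      (Finset.univ : Finset (Fin 4))) 0))
    (hfm : Measurable f) :
    ∫ U, f U ∂(ymSpecification ρ β (({0} : Finset (Fin 4 → ℤ)).biUnion (fun y : Fin 4 → ℤ =>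
        (Fintype.piFinset fun i : Fin 4 => Finset.Ico (w i (y i)) (w i (y i + 1))) ×ˢ (Finset.univ : Finset (Fin 4)))) η) =
      ∫ U, f U ∂(ymSpecification ρ β (({0} : Finset (Fin 4 → ℤ)).biUnion (fun y : Fin 4 → ℤ =>
        (Fintype.piFinset fun i : Fin 4 => Finset.Ico (w i (y i)) (w i (y i + 1))) ×ˢ (Finset.univ : Finset (Fin 4)))) η') := by
  refine integral_ymSpecification_eq_of_interior ρ hρ β hb hw (fun y hy i => ?_) hηη' hf hfm
  rw [Finset.mem_singleton] at hy
  subst hy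
  have hn' : (1 : ℤ) ≤ (n : ℤ) := by exact_mod_cast hn
  simp only [Pi.zero_apply]
  omega

end Summit.QuantumFields.YangMills.Cruxes.CrossoverCertificate.Birth

end
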